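import Literature.Geometry.Lorentzian.KerrFramedCompactness
import HarnessLib

/-!
# NoC0KerrChart, tube analysis III: transplanting timelike-with-margin curves to perturbed cone fields

Line `only-the-third-law-is-generic` of crux `CaptureSufficesTame` (stmt-FinalStateConjecture-17270), stub
`stub_noC0_tubeAnalysis` (helper file, registered sub-goal `stub_noC0_tubeTransplant`), lead c10.

`NoC0.kerr_transplant`: let `K₁ ⊆ E4` be compact with `cthickening δ₀ K₁` inside the Kerr exterior, and let
`c : [0, L] → K₁` be a coordinate curve with continuous derivative `c'`, `g(c r)(c' r, c' r) < 0` and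
`(c' r)⁰ > 0`. Then there is `δ ∈ (0, δ₀]` such that for all `‖z₁‖, ‖z₂‖ < δ` and every field of bilinear forms
`B` that is `δ`-close to `g_{M,a}` on `cthickening δ₀ K₁`, the sheared curve
`r ↦ c r + (1 − r/L) z₁ + (r/L) z₂` (from `c 0 + z₁` to `c L + z₂`) stays in `thickening δ₀ K₁`, has derivative
`c' r + L⁻¹ (z₂ − z₁)`, and is `B`-timelike and future. Proof: by compactness the margins
`−m = max g(c r)(c' r, c' r) < 0`, `m₀ = min (c' r)⁰ > 0`, `C = max ‖c' r‖` exist; the map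
`(r, u, v) ↦ g(c r + u)(c' r + v, c' r + v)` is uniformly continuous on the compact
`[0, L] × B̄(0, δ₀) × B̄(0, 1)` (continuity of the Kerr–Schild components on the exterior,
`Kerr.contDiffOn_bilin_region`), and `|B(w, w) − g(w, w)| ≤ δ (C + 1)²`.

References: B. O'Neill, *Semi-Riemannian geometry*, Academic Press 1983, Ch. 5, Lemma 5.26 ff. (open timecones);
M. Visser, arXiv:0706.0622, (32)–(35) (key `arXiv07060622`).
-/

set_option linter.dupNamespace false
set_option maxSynthPendingDepth 3

noncomputable section

open Set Filter Function Metric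
open scoped Topology

namespace Summit.FinalStateConjecture.FinalStateConjecture.Theorems.PhaseMixingCaptureCaptureSufficesTame

open Literature.Geometry.Lorentzian

namespace NoC0

/-- A convex combination of two norms below `δ` is below `δ`. [folklore] -/
theorem norm_convex_comb_lt {z₁ z₂ : E4} {t δ : ℝ} (ht0 : 0 ≤ t) (ht1 : t ≤ 1) (h₁ : ‖z₁‖ < δ)
    (h₂ : ‖z₂‖ < δ) : ‖(1 - t) • z₁ + t • z₂‖ < δ := by
  have hmax : max ‖z₁‖ ‖z₂‖ < δ := max_lt h₁ h₂
  calc ‖(1 - t) • z₁ + t • z₂‖ ≤ ‖(1 - t) • z₁‖ + ‖t • z₂‖ := norm_add_le _ _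
    _ = (1 - t) * ‖z₁‖ + t * ‖z₂‖ := by
        rw [norm_smul, norm_smul, Real.norm_of_nonneg (by linarith), Real.norm_of_nonneg ht0]
    _ ≤ (1 - t) * max ‖z₁‖ ‖z₂‖ + t * max ‖z₁‖ ‖z₂‖ :=
        add_le_add (mul_le_mul_of_nonneg_left (le_max_left _ _) (by linarith))
          (mul_le_mul_of_nonneg_left (le_max_right _ _) ht0)
    _ = max ‖z₁‖ ‖z₂‖ := by ring
    _ < δ := hmax

/-- The sheared curve `r ↦ c r + (1 − r/L) z₁ + (r/L) z₂` has derivative `c' r + L⁻¹ (z₂ − z₁)` wherever `c` has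
derivative `c' r`. [folklore] -/
theorem hasDerivAt_shear {c : ℝ → E4} {c'r : E4} {r : ℝ} (hc : HasDerivAt c c'r r) (L : ℝ) (z₁ z₂ : E4) :
    HasDerivAt (fun r ↦ c r + (1 - r / L) • z₁ + (r / L) • z₂) (c'r + (1 / L) • (z₂ - z₁)) r := by
  have h2 : HasDerivAt (fun r : ℝ ↦ r / L) (1 / L) r := (hasDerivAt_id' r).div_const L
  have h1 : HasDerivAt (fun r : ℝ ↦ 1 - r / L) (-(1 / L)) r := by simpa using h2.const_sub 1
  have h := (hc.fun_add (h1.smul_const z₁)).fun_add (h2.smul_const z₂)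
  refine h.congr_deriv ?_
  rw [smul_sub, neg_smul]
  abel

/-- **The uniform timelike margin of a compact family.** For `c, c'` continuous on `[0, L]` with `c r ∈ K₁`,
`cthickening δ₀ K₁` inside the Kerr exterior and `g(c r)(c' r, c' r) < 0`, there are `m > 0` and `η > 0` with
`g(c r + u)(c' r + v, c' r + v) < −m` whenever `‖u‖ ≤ δ₀`, `‖v‖ ≤ 1`, `‖u‖, ‖v‖ < η`: the maximum of
`g(c r)(c' r, c' r)` on `[0, L]` is negative and `(r, u, v) ↦ g(c r + u)(c' r + v, c' r + v)` is uniformly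
continuous on the compact `[0, L] × B̄(0, δ₀) × B̄(0, 1)` (continuity of the Kerr–Schild components on the
exterior, `Kerr.contDiffOn_bilin_region`). Visser arXiv:0706.0622, (32)–(35). [cite: arXiv07060622, (32)–(35)] -/
theorem kerr_transplant_margin (M a : ℝ) (K₁ : Set E4) (δ₀ : ℝ) (hδ₀ : 0 < δ₀)
    (hKext : cthickening δ₀ K₁ ⊆ (Kerr.exterior M a : Set E4)) (c c' : ℝ → E4) (L : ℝ) (hL : 0 ≤ L)
    (hcc : ContinuousOn c (Icc 0 L)) (hc' : ContinuousOn c' (Icc 0 L))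
    (h : ∀ r ∈ Icc 0 L, c r ∈ K₁ ∧ Kerr.bilin M a (c r) (c' r) (c' r) < 0) :
    ∃ m > 0, ∃ η > 0, ∀ r ∈ Icc 0 L, ∀ u v : E4, ‖u‖ ≤ δ₀ → ‖v‖ ≤ 1 → ‖u‖ < η → ‖v‖ < η →
      Kerr.bilin M a (c r + u) (c' r + v) (c' r + v) < -m := by
  have hIc : IsCompact (Icc (0 : ℝ) L) := isCompact_Icc
  have hIne : (Icc (0 : ℝ) L).Nonempty := nonempty_Icc.2 hL
  -- the three-variable function `G (r, u, v) = g(c r + u)(c' r + v, c' r + v)` on a compact set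
  set G : ℝ × E4 × E4 → ℝ := fun p ↦ Kerr.bilin M a (c p.1 + p.2.1) (c' p.1 + p.2.2) (c' p.1 + p.2.2) with hG
  set S : Set (ℝ × E4 × E4) := Icc 0 L ×ˢ (closedBall (0 : E4) δ₀ ×ˢ closedBall (0 : E4) 1) with hS
  have hSc : IsCompact S := hIc.prod ((isCompact_closedBall 0 δ₀).prod (isCompact_closedBall 0 1))
  have hfst : ∀ p ∈ S, p.1 ∈ Icc 0 L := fun p hp ↦ (mem_prod.1 hp).1
  have hGc : ContinuousOn G S := by
    have h1 : ContinuousOn (fun p : ℝ × E4 × E4 ↦ c p.1 + p.2.1) S :=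
      (hcc.comp continuous_fst.continuousOn hfst).add continuous_snd.fst.continuousOn
    have h1m : MapsTo (fun p : ℝ × E4 × E4 ↦ c p.1 + p.2.1) S (Kerr.exterior M a : Set E4) := by
      intro p hp
      have hr : p.1 ∈ Icc 0 L := (mem_prod.1 hp).1
      have hu : p.2.1 ∈ closedBall (0 : E4) δ₀ := (mem_prod.1 (mem_prod.1 hp).2).1
      refine hKext (mem_cthickening_of_dist_le _ _ _ _ (h p.1 hr).1 ?_)
      rwa [dist_eq_norm, add_sub_cancel_left, ← mem_closedBall_zero_iff]
    have h2 : ContinuousOn (fun p : ℝ × E4 × E4 ↦ Kerr.bilin M a (c p.1 + p.2.1)) S :=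
      (Kerr.contDiffOn_bilin_region M a (Kerr.rPlus M a) (n := 0)).continuousOn.comp h1 h1m
    have h3 : ContinuousOn (fun p : ℝ × E4 × E4 ↦ c' p.1 + p.2.2) S :=
      (hc'.comp continuous_fst.continuousOn hfst).add continuous_snd.snd.continuousOn
    have h4 : Continuous fun p : (E4 →L[ℝ] E4 →L[ℝ] ℝ) × E4 ↦ p.1 p.2 p.2 := by fun_prop
    exact h4.comp_continuousOn (h2.prodMk h3)
  have hGu : UniformContinuousOn G S := hSc.uniformContinuousOn_of_continuous hGc
  have hS0 : ∀ r ∈ Icc 0 L, ((r, 0, 0) : ℝ × E4 × E4) ∈ S := fun r hr ↦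
    mem_prod.2 ⟨hr, mem_prod.2 ⟨mem_closedBall_self hδ₀.le, mem_closedBall_self zero_le_one⟩⟩
  have hG0 : ∀ r, G (r, 0, 0) = Kerr.bilin M a (c r) (c' r) (c' r) := fun r ↦ by
    simp only [hG, add_zero]
  -- margin: the maximum of `g(c r)(c' r, c' r)` on `[0, L]` is negative
  have hg0 : ContinuousOn (fun r ↦ Kerr.bilin M a (c r) (c' r) (c' r)) (Icc 0 L) := by
    have h1 : ContinuousOn (fun r : ℝ ↦ ((r, 0, 0) : ℝ × E4 × E4)) (Icc 0 L) := by fun_prop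
    have h2 := hGc.comp h1 fun r hr ↦ hS0 r hr
    refine h2.congr fun r _ ↦ ?_
    simp only [comp_apply, hG0]
  obtain ⟨r₁, hr₁, hmax⟩ := hIc.exists_isMaxOn hIne hg0
  set m := -Kerr.bilin M a (c r₁) (c' r₁) (c' r₁) with hm_def
  have hm0 : 0 < m := by have := (h r₁ hr₁).2; linarith
  have hmle : ∀ r ∈ Icc 0 L, Kerr.bilin M a (c r) (c' r) (c' r) ≤ -m := fun r hr ↦ by
    have := hmax hr
    simp only [mem_setOf_eq] at this
    linarith
  -- uniform continuity modulus `η` for `m / 2`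
  obtain ⟨η, hη, hηG⟩ := Metric.uniformContinuousOn_iff.1 hGu (m / 2) (by positivity)
  refine ⟨m / 2, by positivity, η, hη, fun r hr u v huδ hv1 huη hvη ↦ ?_⟩
  have hmem : ((r, u, v) : ℝ × E4 × E4) ∈ S :=
    mem_prod.2 ⟨hr, mem_prod.2 ⟨mem_closedBall_zero_iff.2 huδ, mem_closedBall_zero_iff.2 hv1⟩⟩
  have hdist : dist ((r, u, v) : ℝ × E4 × E4) (r, 0, 0) < η := by
    rw [Prod.dist_eq, Prod.dist_eq, dist_self, dist_zero_right, dist_zero_right]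
    exact max_lt hη (max_lt huη hvη)
  have hGclose := hηG (r, u, v) hmem (r, 0, 0) (hS0 r hr) hdist
  rw [Real.dist_eq, hG0] at hGclose
  have hGuv : G (r, u, v) = Kerr.bilin M a (c r + u) (c' r + v) (c' r + v) := by simp only [hG]
  rw [hGuv] at hGclose
  have := (abs_lt.1 hGclose).2
  linarith [hmle r hr]

/-- **Transplanting a timelike-with-margin curve to a perturbed cone field** (see the file header): the
uniform `δ ∈ (0, δ₀]` for endpoint shears `‖z₁‖, ‖z₂‖ < δ` and bilinear-form fields `B` `δ`-close to `g_{M,a}`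
on `cthickening δ₀ K₁`. Compactness (extreme values of `g(c', c')`, `(c')⁰`, `‖c'‖` on `[0, L]`,
`kerr_transplant_margin`) and the operator-norm estimate `|B(w,w) − g(w,w)| ≤ ‖B − g‖ ‖w‖²`. O'Neill 1983,
Ch. 5 (timecones are open); Visser arXiv:0706.0622, (32)–(35). [cite: arXiv07060622, (32)–(35)] -/
theorem kerr_transplant (M a : ℝ) (K₁ : Set E4) (δ₀ : ℝ) (_hM : 0 ≤ M) (_hK : IsCompact K₁) (hδ₀ : 0 < δ₀)
    (hKext : cthickening δ₀ K₁ ⊆ (Kerr.exterior M a : Set E4)) (c c' : ℝ → E4) (L : ℝ) (hL : 0 < L)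
    (hc : ∀ r ∈ Icc 0 L, HasDerivAt c (c' r) r) (hc' : ContinuousOn c' (Icc 0 L))
    (h : ∀ r ∈ Icc 0 L, c r ∈ K₁ ∧ Kerr.bilin M a (c r) (c' r) (c' r) < 0 ∧ 0 < c' r 0) :
    ∃ δ > 0, δ ≤ δ₀ ∧ ∀ (z₁ z₂ : E4), ‖z₁‖ < δ → ‖z₂‖ < δ → ∀ B : E4 → E4 →L[ℝ] E4 →L[ℝ] ℝ,
      (∀ y ∈ cthickening δ₀ K₁, ‖B y - Kerr.bilin M a y‖ < δ) →
      ∀ r ∈ Icc 0 L, c r + (1 - r / L) • z₁ + (r / L) • z₂ ∈ thickening δ₀ K₁ ∧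
        HasDerivAt (fun r ↦ c r + (1 - r / L) • z₁ + (r / L) • z₂) (c' r + (1 / L) • (z₂ - z₁)) r ∧
        B (c r + (1 - r / L) • z₁ + (r / L) • z₂) (c' r + (1 / L) • (z₂ - z₁)) (c' r + (1 / L) • (z₂ - z₁)) < 0 ∧
        0 < (c' r + (1 / L) • (z₂ - z₁)) 0 := by
  have hcc : ContinuousOn c (Icc 0 L) := fun r hr ↦ (hc r hr).continuousAt.continuousWithinAt
  have hIc : IsCompact (Icc (0 : ℝ) L) := isCompact_Icc
  have hIne : (Icc (0 : ℝ) L).Nonempty := nonempty_Icc.2 hL.le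
  -- uniform margin, speed bound, minimal time component
  obtain ⟨m, hm0, η, hη, hmargin⟩ := kerr_transplant_margin M a K₁ δ₀ hδ₀ hKext c c' L hL.le hcc hc'
    fun r hr ↦ ⟨(h r hr).1, (h r hr).2.1⟩
  obtain ⟨Cb, hCb⟩ := hIc.exists_bound_of_continuousOn hc'
  have hCb0 : 0 ≤ Cb := (norm_nonneg _).trans (hCb 0 (left_mem_Icc.2 hL.le))
  have hc0 : ContinuousOn (fun r ↦ c' r 0) (Icc 0 L) :=
    (EuclideanSpace.proj (0 : Fin 4) : E4 →L[ℝ] ℝ).continuous.comp_continuousOn hc'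
  obtain ⟨r₂, hr₂, hmin⟩ := hIc.exists_isMinOn hIne hc0
  set m₀ := c' r₂ 0 with hm₀_def
  have hm₀ : 0 < m₀ := (h r₂ hr₂).2.2
  have hm₀le : ∀ r ∈ Icc 0 L, m₀ ≤ c' r 0 := fun r hr ↦ hmin hr
  -- the choice of `δ`
  set A₁ := min δ₀ (η / 2) with hA₁
  set A₂ := min (η * L / 2) (L / 2) with hA₂
  set A₃ := min (m / (Cb + 1) ^ 2) (m₀ * L / 4) with hA₃
  set δ := min A₁ (min A₂ A₃) with hδ_def
  have hδA₁ : δ ≤ A₁ := min_le_left _ _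
  have hδA₂ : δ ≤ A₂ := (min_le_right _ _).trans (min_le_left _ _)
  have hδA₃ : δ ≤ A₃ := (min_le_right _ _).trans (min_le_right _ _)
  have hδδ₀ : δ ≤ δ₀ := hδA₁.trans (min_le_left _ _)
  have hδη : δ ≤ η / 2 := hδA₁.trans (min_le_right _ _)
  have hδηL : δ ≤ η * L / 2 := hδA₂.trans (min_le_left _ _)
  have hδL : δ ≤ L / 2 := hδA₂.trans (min_le_right _ _)
  have hδm : δ ≤ m / (Cb + 1) ^ 2 := hδA₃.trans (min_le_left _ _)
  have hδm₀ : δ ≤ m₀ * L / 4 := hδA₃.trans (min_le_right _ _)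
  have hδ : 0 < δ := by positivity
  clear_value δ A₁ A₂ A₃ m₀
  refine ⟨δ, hδ, hδδ₀, fun z₁ z₂ hz₁ hz₂ B hB r hr ↦ ?_⟩
  have hrL0 : 0 ≤ r / L := div_nonneg hr.1 hL.le
  have hrL1 : r / L ≤ 1 := (div_le_one hL).2 hr.2
  set u : E4 := (1 - r / L) • z₁ + (r / L) • z₂ with hu_def
  set v : E4 := (1 / L) • (z₂ - z₁) with hv_def
  have hpt : c r + (1 - r / L) • z₁ + (r / L) • z₂ = c r + u := by rw [hu_def, add_assoc]
  have hu : ‖u‖ < δ := norm_convex_comb_lt hrL0 hrL1 hz₁ hz₂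
  clear_value u
  have hv : ‖v‖ < 2 * δ / L := by
    rw [hv_def, norm_smul, Real.norm_of_nonneg (by positivity : (0 : ℝ) ≤ 1 / L)]
    calc 1 / L * ‖z₂ - z₁‖ ≤ 1 / L * (‖z₂‖ + ‖z₁‖) := by gcongr; exact norm_sub_le _ _
      _ < 1 / L * (δ + δ) := by gcongr
      _ = 2 * δ / L := by ring
  have hvη : ‖v‖ < η := hv.trans_le (by rw [div_le_iff₀ hL]; linarith)
  have hv1 : ‖v‖ ≤ 1 := (hv.trans_le (by rw [div_le_iff₀ hL]; linarith)).le
  clear_value v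
  have hv0 : |v 0| < 2 * δ / L := by
    have h1 : |v 0| ≤ ‖v‖ := by
      rw [← Real.norm_eq_abs]
      exact PiLp.norm_apply_le v 0
    exact h1.trans_lt hv
  -- the perturbed point stays in the thickening, the metric has margin `m` there
  have hptK : c r + u ∈ thickening δ₀ K₁ := by
    rw [mem_thickening_iff]
    refine ⟨c r, (h r hr).1, ?_⟩
    rw [dist_eq_norm, add_sub_cancel_left]
    exact hu.trans_le hδδ₀
  have hg_neg : Kerr.bilin M a (c r + u) (c' r + v) (c' r + v) < -m :=
    hmargin r hr u v (hu.le.trans hδδ₀) hv1 (hu.trans_le (hδη.trans (by linarith))) hvη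
  -- the `B`-error
  have hw : ‖c' r + v‖ ≤ Cb + 1 := (norm_add_le _ _).trans (add_le_add (hCb r hr) hv1)
  have hBerr : |B (c r + u) (c' r + v) (c' r + v) - Kerr.bilin M a (c r + u) (c' r + v) (c' r + v)| ≤ m := by
    have h1 := (B (c r + u) - Kerr.bilin M a (c r + u)).le_opNorm₂ (c' r + v) (c' r + v)
    rw [Real.norm_eq_abs, sub_apply, sub_apply] at h1
    have h2 : ‖B (c r + u) - Kerr.bilin M a (c r + u)‖ ≤ δ :=
      (hB _ (thickening_subset_cthickening _ _ hptK)).le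
    have h3 : ‖B (c r + u) - Kerr.bilin M a (c r + u)‖ * ‖c' r + v‖ * ‖c' r + v‖ ≤ δ * (Cb + 1) * (Cb + 1) :=
      mul_le_mul (mul_le_mul h2 hw (norm_nonneg _) hδ.le) hw (norm_nonneg _) (mul_nonneg hδ.le (by linarith))
    have h4 : δ * (Cb + 1) ^ 2 ≤ m := (le_div_iff₀ (by positivity)).1 hδm
    have h5 : δ * (Cb + 1) * (Cb + 1) = δ * (Cb + 1) ^ 2 := by ring
    linarith
  have hBneg : B (c r + u) (c' r + v) (c' r + v) < 0 := by
    have := (abs_le.1 hBerr).2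
    linarith
  -- the time component
  have htime : 0 < (c' r + v) 0 := by
    rw [PiLp.add_apply]
    have h1 := hm₀le r hr
    have h2 : -(2 * δ / L) < v 0 := (abs_lt.1 hv0).1
    have h3 : 2 * δ / L ≤ m₀ / 2 := by rw [div_le_iff₀ hL]; linarith
    linarith
  subst hv_def
  refine ⟨hpt ▸ hptK, hasDerivAt_shear (hc r hr) L z₁ z₂, ?_, htime⟩
  rw [hpt]
  exact hBneg

end NoC0

/-- **Registered sub-goal `stub_noC0_tubeTransplant`** (helper of `stub_noC0_tubeAnalysis`, NoC0KerrChart programme): the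
transplant statement (TL), verbatim (`NoC0.kerr_transplant`). [cite: arXiv07060622, (32)–(35)] -/
theorem stub_noC0_tubeTransplant :
    ∀ (M a : ℝ) (K₁ : Set E4) (δ₀ : ℝ), 0 ≤ M → IsCompact K₁ → 0 < δ₀ →
      cthickening δ₀ K₁ ⊆ (Kerr.exterior M a : Set E4) →
      ∀ (c c' : ℝ → E4) (L : ℝ), 0 < L → (∀ r ∈ Icc 0 L, HasDerivAt c (c' r) r) → ContinuousOn c' (Icc 0 L) →
      (∀ r ∈ Icc 0 L, c r ∈ K₁ ∧ Kerr.bilin M a (c r) (c' r) (c' r) < 0 ∧ 0 < c' r 0) →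
      ∃ δ > 0, δ ≤ δ₀ ∧ ∀ (z₁ z₂ : E4), ‖z₁‖ < δ → ‖z₂‖ < δ → ∀ B : E4 → E4 →L[ℝ] E4 →L[ℝ] ℝ,
        (∀ y ∈ cthickening δ₀ K₁, ‖B y - Kerr.bilin M a y‖ < δ) →
        ∀ r ∈ Icc 0 L, c r + (1 - r / L) • z₁ + (r / L) • z₂ ∈ thickening δ₀ K₁ ∧
          HasDerivAt (fun r ↦ c r + (1 - r / L) • z₁ + (r / L) • z₂) (c' r + (1 / L) • (z₂ - z₁)) r ∧
          B (c r + (1 - r / L) • z₁ + (r / L) • z₂) (c' r + (1 / L) • (z₂ - z₁)) (c' r + (1 / L) • (z₂ - z₁)) < 0 ∧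
          0 < (c' r + (1 / L) • (z₂ - z₁)) 0 :=
  NoC0.kerr_transplant

end Summit.FinalStateConjecture.FinalStateConjecture.Theorems.PhaseMixingCaptureCaptureSufficesTame

end
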